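import Mathlib
import Literature.NumberTheory.LFunctions.Zhang2022.SmoothWeightMellin
import Literature.NumberTheory.LFunctions.Zhang2022.Section8Reflection
import HarnessLib

/-!
# Zhang (2022) §§14–17: "replacing the segment `𝔍(z)` by the line `σ = z + 1/2` with a negligible
# error" — the Gaussian tail of `ω` beyond `|v| ≤ 𝓛₁`, kernel-checked

Topic `Literature/NumberTheory/LFunctions/Zhang2022` (Landau–Siegel audit tree; verdict-neutral).
Y. Zhang, *Discrete mean estimates and the Landau–Siegel zero*, arXiv:2211.02515v1 (2022)
[Zhang2022LandauSiegel] — **an unrefereed manuscript under adjudication** (cell siegel-zhang, D-0069).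
Companion of `Zhang2022/SmoothWeightMellin.lean` (the term-by-term theorem on the whole line).
The manuscript integrates over the SEGMENT `𝔍(z) = {z + s₀ + iv : |v| ≤ 𝓛₁}` (§7 p. 13; the
tree's `Lemma81.segInt`, `Section8Reflection`) and passes to the whole line in one sentence:
§17 p. 96, tex L4722 "replacing the segment `𝔍(1)` by the line `σ = 3/2` and integrating term by
term"; §14 p. 77, tex L3857 "replace the segment `𝔍(1)` by the vertical line `σ = 3/2` with a
negligible error"; §15 p. 80 (the line `(−1/2)` in `Z22:§15.u009–u010`). This file PROVES the
passage with an explicit bound (`SmoothWeight.norm_lineIntegral_sub_segInt_le`): for a Dirichlet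
series `A(s) = Σ a(m)m^{−s}` absolutely convergent on `σ = z + 1/2`, a Dirichlet polynomial
`Σ_{n∈S} b(n)n^{s−1}` (`0 ∉ S`) and `𝓛₁ ≥ 0`,
`‖(1/2π)∫_ℝ A(s)(Σb(n)n^{s−1})ω(s)dv − (1/2πi)∫_{𝔍(z)} A(s)(Σb(n)n^{s−1})ω(s)ds‖
 ≤ (Σ_m|a(m)|m^{−σ})(Σ_n|b(n)|n^{σ−1}) e^{(z²−𝓛₁²)/(4𝓛₂²)}`
(Gaussian tail of `|ω(z+s₀+iv)| = (√π/𝓛₂)e^{(z²−v²)/(4𝓛₂²)}`, (7.4), via the tree's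
`GaussWeight.integral_gauss_Ioi_le`). At the manuscript's `𝓛₁ = 𝓛⁴⁰⁵ > 𝓛₂ = 𝓛⁴⁰⁰` ((2.15),
§7) the factor is `e^{z²/(4𝓛⁸⁰⁰)}·exp{−𝓛¹⁰/4}`, i.e. `O(ε)`-small (`ε = exp{−c𝓛¹⁰}`-type, §4).
UNCONDITIONAL (no (A), no named fact). Nothing here bears on Theorems 1–2 of the source or on the
cell's verdict.

## References

* Y. Zhang, arXiv:2211.02515v1 (2022), §7 p. 13, (7.4); §14 p. 77; §15 p. 80; §17 p. 96.
  [cite: Zhang2022LandauSiegel, §7 (7.4); §14 p. 77; §17 p. 96]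
-/

noncomputable section

open Complex Real Set MeasureTheory

namespace Literature.NumberTheory.LFunctions.Zhang2022

namespace SmoothWeight

/-! ## "Replacing the segment `𝔍(z)` by the whole line `σ = z + 1/2` with a negligible error" -/

/-- The profile is even in `v`. [folklore] -/
private theorem profile_neg (L₂ z v : ℝ) :
    Real.sqrt π / L₂ * Real.exp ((z ^ 2 - (-v) ^ 2) / (4 * L₂ ^ 2))
      = Real.sqrt π / L₂ * Real.exp ((z ^ 2 - v ^ 2) / (4 * L₂ ^ 2)) := by
  rw [neg_sq]

/-- **Gaussian tail of `|ω|` beyond `𝔍(z)`**: for `L₁ ≥ 0`,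
`∫_{v > L₁} (√π/𝓛₂)e^{(z²−v²)/(4𝓛₂²)} dv ≤ π·e^{(z²−L₁²)/(4𝓛₂²)}`.
[cite: Zhang2022LandauSiegel, §7 (7.4); §17 p. 96 ("with a negligible error")] -/
theorem integral_profile_Ioi_le {L₂ : ℝ} (hL : 0 < L₂) (z : ℝ) {L₁ : ℝ} (hL₁ : 0 ≤ L₁) :
    ∫ v in Ioi L₁, Real.sqrt π / L₂ * Real.exp ((z ^ 2 - v ^ 2) / (4 * L₂ ^ 2))
      ≤ π * Real.exp ((z ^ 2 - L₁ ^ 2) / (4 * L₂ ^ 2)) := by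
  have hΛ : 0 < 1 / (4 * L₂ ^ 2) := by positivity
  simp_rw [profile_eq]
  rw [integral_const_mul]
  have htail := GaussWeight.integral_gauss_Ioi_le hΛ hL₁
  have hgauss : (fun v : ℝ => Real.exp (-(1 / (4 * L₂ ^ 2)) * v ^ 2)) = GaussWeight.gauss (1 / (4 * L₂ ^ 2)) :=
    rfl
  rw [hgauss]
  have hsq : Real.sqrt (π / (1 / (4 * L₂ ^ 2))) = 2 * L₂ * Real.sqrt π := by
    rw [show π / (1 / (4 * L₂ ^ 2)) = (2 * L₂) ^ 2 * π by field_simp; ring,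
      Real.sqrt_mul (by positivity), Real.sqrt_sq (by positivity)]
  rw [hsq] at htail
  have hC : 0 ≤ Real.sqrt π / L₂ * Real.exp (z ^ 2 / (4 * L₂ ^ 2)) := by positivity
  calc Real.sqrt π / L₂ * Real.exp (z ^ 2 / (4 * L₂ ^ 2)) *
        ∫ v in Ioi L₁, GaussWeight.gauss (1 / (4 * L₂ ^ 2)) v
      ≤ Real.sqrt π / L₂ * Real.exp (z ^ 2 / (4 * L₂ ^ 2)) *
          (GaussWeight.gauss (1 / (4 * L₂ ^ 2)) L₁ * (2 * L₂ * Real.sqrt π / 2)) :=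
        mul_le_mul_of_nonneg_left htail hC
    _ = π * Real.exp ((z ^ 2 - L₁ ^ 2) / (4 * L₂ ^ 2)) := by
        rw [GaussWeight.gauss]
        have hπ : Real.sqrt π * Real.sqrt π = π := Real.mul_self_sqrt Real.pi_pos.le
        rw [show (z ^ 2 - L₁ ^ 2) / (4 * L₂ ^ 2) = z ^ 2 / (4 * L₂ ^ 2) + (-(1 / (4 * L₂ ^ 2)) * L₁ ^ 2)
          by ring, Real.exp_add]
        obtain ⟨r, hr, hr2⟩ : ∃ r : ℝ, Real.sqrt π = r ∧ r * r = π := ⟨_, rfl, hπ⟩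
        rw [hr, ← hr2]
        field_simp

/-- The same tail on the left: `∫_{v < −L₁} = ∫_{v > L₁}` by evenness. [folklore] -/
private theorem integral_profile_Iic_eq {L₂ : ℝ} (z L₁ : ℝ) :
    ∫ v in Iic (-L₁), Real.sqrt π / L₂ * Real.exp ((z ^ 2 - v ^ 2) / (4 * L₂ ^ 2))
      = ∫ v in Ioi L₁, Real.sqrt π / L₂ * Real.exp ((z ^ 2 - v ^ 2) / (4 * L₂ ^ 2)) := by
  rw [← integral_comp_neg_Ioi]
  simp_rw [profile_neg]

/-- The integrand `A(s)(Σ_n b(n)n^{s−1})ω(s)` of the term-by-term step (§17 p. 96, tex L4719–4722)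
is continuous along the line `s = z + s₀ + iv` (`M`-test for the series on `σ = z + 1/2`).
[cite: Zhang2022LandauSiegel, §17 p. 96; §7 (7.4)] -/
theorem continuous_integrand {L₂ : ℝ} (t₀ z : ℝ) {a : ℕ → ℂ}
    (ha : LSeriesSummable a ((z + 1 / 2 : ℝ) : ℂ)) (b : ℕ → ℂ) {S : Finset ℕ} (hS : 0 ∉ S) :
    Continuous fun v : ℝ => LSeries a ((z : ℂ) + s0 t₀ + v * I) *
        (∑ n ∈ S, b n * (n : ℂ) ^ (((z : ℂ) + s0 t₀ + v * I) - 1)) *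
        omega L₂ t₀ ((z : ℂ) + s0 t₀ + v * I) := by
  have hs : Continuous fun v : ℝ => (z : ℂ) + s0 t₀ + v * I := by fun_prop
  refine Continuous.mul (Continuous.mul ?_ ?_) ?_
  · unfold LSeries
    refine continuous_tsum (fun m => ?_) (summable_norm_iff.mpr ha) (fun m v => ?_)
    · rcases eq_or_ne m 0 with rfl | hm
      · simp only [LSeries.term_zero]; exact continuous_const
      · simp_rw [LSeries.term_of_ne_zero hm]
        exact continuous_const.div (Continuous.const_cpow hs (Or.inl (Nat.cast_ne_zero.mpr hm)))
          (fun v h => Nat.cast_ne_zero.mpr hm ((cpow_eq_zero_iff _ _).mp h).1)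
    · rw [LSeries.norm_term_eq, LSeries.norm_term_eq, linePoint_re, ofReal_re]
  · refine continuous_finsetSum _ fun n hn => continuous_const.mul ?_
    exact Continuous.const_cpow (hs.sub continuous_const)
      (Or.inl (Nat.cast_ne_zero.mpr fun h => hS (h ▸ hn)))
  · unfold omega; fun_prop

/-- Pointwise majorant of the integrand: `|A(s)·(Σ b(n)n^{s−1})·ω(s)| ≤ (Σ_m|a(m)|m^{−σ})·
(Σ_n |b(n)|n^{σ−1})·(√π/𝓛₂)e^{(z²−v²)/(4𝓛₂²)}`, `σ = z + 1/2`. [cite: Zhang2022LandauSiegel, §7 (7.4)] -/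
theorem norm_integrand_le {L₂ : ℝ} (hL : 0 < L₂) (t₀ z : ℝ) {a : ℕ → ℂ}
    (ha : LSeriesSummable a ((z + 1 / 2 : ℝ) : ℂ)) (b : ℕ → ℂ) {S : Finset ℕ} (hS : 0 ∉ S) (v : ℝ) :
    ‖LSeries a ((z : ℂ) + s0 t₀ + v * I) *
        (∑ n ∈ S, b n * (n : ℂ) ^ (((z : ℂ) + s0 t₀ + v * I) - 1)) *
        omega L₂ t₀ ((z : ℂ) + s0 t₀ + v * I)‖
      ≤ (∑' m : ℕ, ‖LSeries.term a ((z + 1 / 2 : ℝ) : ℂ) m‖) *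
          (∑ n ∈ S, ‖b n‖ * (n : ℝ) ^ (z + 1 / 2 - 1)) *
          (Real.sqrt π / L₂ * Real.exp ((z ^ 2 - v ^ 2) / (4 * L₂ ^ 2))) := by
  have hsum : Summable fun m : ℕ => ‖LSeries.term a ((z + 1 / 2 : ℝ) : ℂ) m‖ :=
    summable_norm_iff.mpr ha
  rw [norm_mul, norm_mul, norm_omega_segment_eq hL]
  have h1 : ‖LSeries a ((z : ℂ) + s0 t₀ + v * I)‖ ≤ ∑' m : ℕ, ‖LSeries.term a ((z + 1 / 2 : ℝ) : ℂ) m‖ := by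
    have e : ∀ m, ‖LSeries.term a ((z : ℂ) + s0 t₀ + v * I) m‖
        = ‖LSeries.term a ((z + 1 / 2 : ℝ) : ℂ) m‖ := fun m => by
      rw [LSeries.norm_term_eq, LSeries.norm_term_eq, linePoint_re, ofReal_re]
    rw [LSeries, ← tsum_congr e]
    exact norm_tsum_le_tsum_norm ((summable_congr e).mpr hsum)
  have h2 : ‖∑ n ∈ S, b n * (n : ℂ) ^ (((z : ℂ) + s0 t₀ + v * I) - 1)‖
      ≤ ∑ n ∈ S, ‖b n‖ * (n : ℝ) ^ (z + 1 / 2 - 1) := by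
    refine (norm_sum_le _ _).trans (le_of_eq (Finset.sum_congr rfl fun n hn => ?_))
    have hn' : (0 : ℝ) < n := Nat.cast_pos.mpr (Nat.pos_of_ne_zero fun h => hS (h ▸ hn))
    rw [norm_mul, ← Complex.ofReal_natCast, Complex.norm_cpow_eq_rpow_re_of_pos hn', sub_re,
      linePoint_re, one_re]
  have h0 : 0 ≤ Real.sqrt π / L₂ * Real.exp ((z ^ 2 - v ^ 2) / (4 * L₂ ^ 2)) := by positivity
  exact mul_le_mul_of_nonneg_right
    (mul_le_mul h1 h2 (norm_nonneg _) (tsum_nonneg fun m => norm_nonneg _)) h0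

/-- The integrand `A(s)(Σ_n b(n)n^{s−1})ω(s)` is absolutely integrable on the line `s = z + s₀ + iv`
(Gaussian majorant (7.4)). [cite: Zhang2022LandauSiegel, §17 p. 96; §7 (7.4)] -/
theorem integrable_integrand {L₂ : ℝ} (hL : 0 < L₂) (t₀ z : ℝ) {a : ℕ → ℂ}
    (ha : LSeriesSummable a ((z + 1 / 2 : ℝ) : ℂ)) (b : ℕ → ℂ) {S : Finset ℕ} (hS : 0 ∉ S) :
    Integrable fun v : ℝ => LSeries a ((z : ℂ) + s0 t₀ + v * I) *
        (∑ n ∈ S, b n * (n : ℂ) ^ (((z : ℂ) + s0 t₀ + v * I) - 1)) *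
        omega L₂ t₀ ((z : ℂ) + s0 t₀ + v * I) :=
  (((integrable_profile hL z).const_mul _)).mono'
    (continuous_integrand t₀ z ha b hS).aestronglyMeasurable
    (ae_of_all _ fun v => norm_integrand_le hL t₀ z ha b hS v)

/-- **"Replacing the segment `𝔍(z)` by the line with a negligible error"** (§17 p. 96, tex L4722:
"replacing the segment `𝔍(1)` by the line `σ = 3/2`"; §14 p. 77, tex L3857; §15 p. 80): with
`𝔍(z) = {z + s₀ + iv : |v| ≤ 𝓛₁}` (§7 p. 13) and the segment integral `Lemma81.segInt`,
`‖(1/2π)∫_ℝ A(s)(Σ_n b(n)n^{s−1})ω(s)dv − (1/2πi)∫_{𝔍(z)} A(s)(Σ_n b(n)n^{s−1})ω(s)ds‖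
≤ (Σ_m |a(m)|m^{−σ})(Σ_n |b(n)|n^{σ−1})·e^{(z²−𝓛₁²)/(4𝓛₂²)}`, `σ = z + 1/2` — at the manuscript's
`𝓛₁ = 𝓛⁴⁰⁵`, `𝓛₂ = 𝓛⁴⁰⁰` ((2.15)) the last factor is `e^{(z²−𝓛¹⁰)/(4𝓛⁸⁰⁰)}·…`, i.e. `O(ε)`-small.
[cite: Zhang2022LandauSiegel, §17 p. 96; §14 p. 77; §7 (7.4)] -/
theorem norm_lineIntegral_sub_segInt_le {L₂ : ℝ} (hL : 0 < L₂) (t₀ z : ℝ) {a : ℕ → ℂ}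
    (ha : LSeriesSummable a ((z + 1 / 2 : ℝ) : ℂ)) (b : ℕ → ℂ) {S : Finset ℕ} (hS : 0 ∉ S)
    {L₁ : ℝ} (hL₁ : 0 ≤ L₁) :
    ‖(1 / (2 * π) : ℂ) * (∫ v : ℝ, LSeries a ((z : ℂ) + s0 t₀ + v * I) *
          (∑ n ∈ S, b n * (n : ℂ) ^ (((z : ℂ) + s0 t₀ + v * I) - 1)) *
          omega L₂ t₀ ((z : ℂ) + s0 t₀ + v * I)) -
        Lemma81.segInt t₀ L₁ z (fun s => LSeries a s * (∑ n ∈ S, b n * (n : ℂ) ^ (s - 1)) *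
          omega L₂ t₀ s)‖
      ≤ (∑' m : ℕ, ‖LSeries.term a ((z + 1 / 2 : ℝ) : ℂ) m‖) *
          (∑ n ∈ S, ‖b n‖ * (n : ℝ) ^ (z + 1 / 2 - 1)) *
          Real.exp ((z ^ 2 - L₁ ^ 2) / (4 * L₂ ^ 2)) := by
  set F : ℝ → ℂ := fun v => LSeries a ((z : ℂ) + s0 t₀ + v * I) *
      (∑ n ∈ S, b n * (n : ℂ) ^ (((z : ℂ) + s0 t₀ + v * I) - 1)) *
      omega L₂ t₀ ((z : ℂ) + s0 t₀ + v * I) with hF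
  set A : ℝ := ∑' m : ℕ, ‖LSeries.term a ((z + 1 / 2 : ℝ) : ℂ) m‖ with hA
  set B : ℝ := ∑ n ∈ S, ‖b n‖ * (n : ℝ) ^ (z + 1 / 2 - 1) with hB
  set prof : ℝ → ℝ := fun v => Real.sqrt π / L₂ * Real.exp ((z ^ 2 - v ^ 2) / (4 * L₂ ^ 2))
    with hprof
  have hFi : Integrable F := integrable_integrand hL t₀ z ha b hS
  have hprofi : Integrable prof := integrable_profile hL z
  have hAB : 0 ≤ A * B :=
    mul_nonneg (tsum_nonneg fun m => norm_nonneg _) (Finset.sum_nonneg fun n _ => by positivity)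
  have hptw : ∀ v, ‖F v‖ ≤ A * B * prof v := fun v => norm_integrand_le hL t₀ z ha b hS v
  -- the segment integral is the integral over `Ioc (−L₁) L₁`
  have hseg : Lemma81.segInt t₀ L₁ z (fun s => LSeries a s * (∑ n ∈ S, b n * (n : ℂ) ^ (s - 1)) *
      omega L₂ t₀ s) = (1 / (2 * π) : ℂ) * ∫ v in Ioc (-L₁) L₁, F v := by
    rw [Lemma81.segInt_def, intervalIntegral.integral_of_le (by linarith)]
  -- splitting the line
  have hsplit : ∫ v : ℝ, F v
      = (∫ v in Iic (-L₁), F v) + (∫ v in Ioc (-L₁) L₁, F v) + ∫ v in Ioi L₁, F v := by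
    rw [← integral_add_compl (measurableSet_Iic (a := L₁)) hFi, compl_Iic,
      ← Iic_union_Ioc_eq_Iic (show -L₁ ≤ L₁ by linarith),
      setIntegral_union (Iic_disjoint_Ioc le_rfl) measurableSet_Ioc hFi.integrableOn hFi.integrableOn]
  have hdiff : (1 / (2 * π) : ℂ) * (∫ v : ℝ, F v) -
      Lemma81.segInt t₀ L₁ z (fun s => LSeries a s * (∑ n ∈ S, b n * (n : ℂ) ^ (s - 1)) *
        omega L₂ t₀ s)
      = (1 / (2 * π) : ℂ) * ((∫ v in Iic (-L₁), F v) + ∫ v in Ioi L₁, F v) := by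
    rw [hseg, hsplit]; ring
  -- the two tails
  have htail : ∀ s : Set ℝ, MeasurableSet s → ‖∫ v in s, F v‖ ≤ A * B * ∫ v in s, prof v := by
    intro s hs
    calc ‖∫ v in s, F v‖ ≤ ∫ v in s, ‖F v‖ := norm_integral_le_integral_norm _
      _ ≤ ∫ v in s, A * B * prof v :=
          setIntegral_mono hFi.norm.integrableOn (hprofi.const_mul _).integrableOn hptw
      _ = A * B * ∫ v in s, prof v := integral_const_mul _ _
  have hIoi : ∫ v in Ioi L₁, prof v ≤ π * Real.exp ((z ^ 2 - L₁ ^ 2) / (4 * L₂ ^ 2)) :=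
    integral_profile_Ioi_le hL z hL₁
  have hIic : ∫ v in Iic (-L₁), prof v ≤ π * Real.exp ((z ^ 2 - L₁ ^ 2) / (4 * L₂ ^ 2)) := by
    rw [hprof, integral_profile_Iic_eq z L₁]; exact hIoi
  have hπ : ‖(1 / (2 * π) : ℂ)‖ = 1 / (2 * π) := by
    rw [show (1 / (2 * π) : ℂ) = ((1 / (2 * π) : ℝ) : ℂ) by push_cast; ring, Complex.norm_real,
      Real.norm_of_nonneg (by positivity)]
  change ‖(1 / (2 * π) : ℂ) * (∫ v : ℝ, F v) - _‖ ≤ _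
  rw [hdiff, norm_mul, hπ]
  calc 1 / (2 * π) * ‖(∫ v in Iic (-L₁), F v) + ∫ v in Ioi L₁, F v‖
      ≤ 1 / (2 * π) * (A * B * (π * Real.exp ((z ^ 2 - L₁ ^ 2) / (4 * L₂ ^ 2))) +
          A * B * (π * Real.exp ((z ^ 2 - L₁ ^ 2) / (4 * L₂ ^ 2)))) := by
        gcongr
        refine (norm_add_le _ _).trans (add_le_add ?_ ?_)
        · exact (htail _ measurableSet_Iic).trans (mul_le_mul_of_nonneg_left hIic hAB)
        · exact (htail _ measurableSet_Ioi).trans (mul_le_mul_of_nonneg_left hIoi hAB)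
    _ = A * B * Real.exp ((z ^ 2 - L₁ ^ 2) / (4 * L₂ ^ 2)) := by
        field_simp
        ring

end SmoothWeight

end Literature.NumberTheory.LFunctions.Zhang2022
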